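import Summits.ABC.IUTFork.Cor312HullGlued
import Summits.ABC.IUTFork.Cor312SettingReal
import HarnessLib

/-!
# [IUTchIII] Cor. 3.12 — the hull-glued setting AT THE REAL FRAMES: the indeterminacy hypothesis reduced to the
# (Ind1)/(Ind2) GENERATORS, and the Statement-invariance / `BridgeHyps`-transport at `Setting.ofComparison`

PROOF-ONLY sequel (abc-iut cell, seat abc-iut-w5-d060, WAVE-5) of p418697 `Cor312HullGlued` / p417756
`Cor312HullReglue`. TAKES NO SIDE on [IUTchIII] Cor. 3.12. No definition, no `Prop` fact.

Those files leave ONE hypothesis on the indeterminacies explicit: `hHul` — every `Φ` in the indeterminacy group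
`indGroup S = ⟨Ind1Family ∪ Ind2Family⟩` maps the hull-sets of the packet frame to hull-sets. THIS FILE

* §1 `image_preimage_eq_preimage_image_of_intertwined` — transport of preimages along an intertwining
  `e ∘ Φ = Ψ ∘ e` with bijections `Φ`, `Ψ`: `Φ '' e⁻¹(H) = e⁻¹(Ψ '' H)` for EVERY `H` (the set-valued form of
  abc-iut-c312-9's `image_preimage_eq_of_intertwined`);
* §2 **`Setting.mapsHul_comap_of_generators`** — REDUCES `hHul` for a frame pulled back along a comparison
  `e : packet → Y` (c312-7's `HullFrame.comap`, in particular the real frames `HullFrame.ofComparison`) to the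
  GENERATORS: if every (Ind1)- and (Ind2)-family is intertwined along `e` with a bijection `Ψ` of `Y` such that
  `Ψ` and `Ψ⁻¹` map hull-sets to hull-sets (the shape of abc-iut-c312-5's naturality squares / Dupuy–Hilado §4.7,
  §4.9: permutations of the summands and unit isometries carry polydiscs `λ·𝒪_L` to polydiscs), then EVERY
  element of the generated group maps pulled-back hull-sets to pulled-back hull-sets (closure induction on the
  two-sided property);
* §3 at abc-iut-c312-7's **`Setting.ofComparison`** (settings ASSEMBLED OVER REAL PACKETS; frames = the real
  frames pulled back, `ofComparison_frame`): with surjective comparisons and the generator hypothesis at the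
  label packets, the three frame hypotheses of `Cor312HullGlued` are ALL met (`hHas`/`hdeg` by its §5, `hHul`
  by §2), whence **`hullGlued_statement_iff_ofComparison`** (the hull-glued setting has the SAME typed
  Statement), `hullGlued_negLogTheta_ofComparison`, and **`bridgeHyps_hullGlued_ofComparison`** /
  `hullGlued_summary_ofComparison` (`BridgeHyps` transported, `ThetaRegionsAdm` and `hθ` at every label packet
  for free).

Reading (neutral): at the real frames of record the bracket p416677 / p417756 / p418697 holds under exactly
two NAMED, print-shaped hypotheses — surjective comparison maps ([IUTchIII] Prop. 3.1 (i)) and generator-level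
hull-set stability of (Ind1)/(Ind2) — both of the kind abc-iut-c312-5's concrete DH files discharge; nothing
here constrains the intended Kummer-isomorphism glue. [claim: Mochizuki2012, status: disputed] vocabulary only.
-/

noncomputable section

open Set

namespace Summit.ABC.IUTFork.Cor312

/-! ## 1. Preimages along an intertwining -/

/-- **Transport of preimages along an intertwining.** If `e ∘ Φ = Ψ ∘ e` with `Φ`, `Ψ` bijections, then
`Φ '' e⁻¹(H) = e⁻¹(Ψ '' H)` for every `H` (the inverses intertwine automatically). [folklore] -/
theorem image_preimage_eq_preimage_image_of_intertwined {α β : Type} (e : α → β) (Φ : α ≃ α) (Ψ : β ≃ β)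
    (hcomm : ∀ x, e (Φ x) = Ψ (e x)) (H : Set β) : ⇑Φ '' (e ⁻¹' H) = e ⁻¹' (⇑Ψ '' H) := by
  have hinv : ∀ y, e (Φ.symm y) = Ψ.symm (e y) := fun y => by
    have h := hcomm (Φ.symm y)
    rw [Φ.apply_symm_apply] at h
    exact (Equiv.eq_symm_apply Ψ).mpr h.symm
  ext y
  constructor
  · rintro ⟨x, hx, rfl⟩
    exact ⟨e x, hx, (hcomm x).symm⟩
  · rintro ⟨z, hz, hzy⟩
    refine ⟨Φ.symm y, ?_, Φ.apply_symm_apply y⟩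
    show e (Φ.symm y) ∈ H
    rw [hinv y, ← hzy, Ψ.symm_apply_apply]
    exact hz

/-! ## 2. `hHul` at a pulled-back frame from the generators of (Ind1), (Ind2) -/

namespace Setting

open Thm311 Literature.IUT.LogThetaLattice

variable {T : ThetaIndex} {S : Situation T}

/-- **The indeterminacy group maps pulled-back hull-sets to pulled-back hull-sets, from the generators.** For a
frame `F.comap e` pulled back along `e : packet → Y`: if every (Ind1)- and (Ind2)-family is intertwined along
`e` with a bijection `Ψ` of `Y` such that `Ψ` and `Ψ⁻¹` map hull-sets of `F` to hull-sets, then so does every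
element of `indGroup S` (closure induction on the two-sided property; Dupuy–Hilado §4.7/§4.9 shape).
[claim: Mochizuki2012, status: disputed] -/
theorem mapsHul_comap_of_generators {j : T.Label} {vQ : T.VQ} {Y : Type} (F : HullFrame Y)
    (e : S.L.Packet j vQ → Y)
    (hgen : ∀ Φ ∈ S.L.Ind1Family ∪ S.L.Ind2Family, ∃ Ψ : Y ≃ Y,
      (∀ x, e (Φ j vQ x) = Ψ (e x)) ∧ (∀ H ∈ F.Hul, ⇑Ψ '' H ∈ F.Hul) ∧ (∀ H ∈ F.Hul, ⇑Ψ.symm '' H ∈ F.Hul))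
    {Φ : S.L.PacketAut} (hΦ : Φ ∈ indGroup S) :
    ∀ H ∈ (F.comap e).Hul, Φ j vQ '' H ∈ (F.comap e).Hul := by
  -- two-sided property, closed under the group operations
  suffices h : (∀ H ∈ (F.comap e).Hul, Φ j vQ '' H ∈ (F.comap e).Hul) ∧
      (∀ H ∈ (F.comap e).Hul, Φ⁻¹ j vQ '' H ∈ (F.comap e).Hul) from h.1
  induction hΦ using Subgroup.closure_induction with
  | mem Φ hΦ =>
    obtain ⟨Ψ, hcomm, hΨ, hΨ'⟩ := hgen Φ hΦ
    have hfwd : ∀ H ∈ (F.comap e).Hul, Φ j vQ '' H ∈ (F.comap e).Hul := by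
      rintro _ ⟨H', hH', rfl⟩
      refine ⟨⇑Ψ '' H', hΨ H' hH', ?_⟩
      have h := image_preimage_eq_preimage_image_of_intertwined e (Φ j vQ).toEquiv Ψ hcomm H'
      rw [LinearEquiv.coe_toEquiv] at h
      exact h
    refine ⟨hfwd, ?_⟩
    rintro _ ⟨H', hH', rfl⟩
    refine ⟨⇑Ψ.symm '' H', hΨ' H' hH', ?_⟩
    have hcomm' : ∀ x, e ((Φ j vQ).symm x) = Ψ.symm (e x) := fun x => by
      have h := hcomm ((Φ j vQ).symm x)
      rw [LinearEquiv.apply_symm_apply] at h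
      exact (Equiv.eq_symm_apply Ψ).mpr h.symm
    have h := image_preimage_eq_preimage_image_of_intertwined e (Φ j vQ).symm.toEquiv Ψ.symm hcomm' H'
    rw [LinearEquiv.coe_toEquiv] at h
    rw [coe_inv_apply]
    exact h
  | one =>
    refine ⟨fun H hH => ?_, fun H hH => ?_⟩
    · simpa using hH
    · rw [inv_one]; simpa using hH
  | mul Φ₁ Φ₂ _ _ ih₁ ih₂ =>
    refine ⟨fun H hH => ?_, fun H hH => ?_⟩
    · rw [coe_mul_apply, Set.image_comp]
      exact ih₁.1 _ (ih₂.1 H hH)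
    · rw [mul_inv_rev, coe_mul_apply, Set.image_comp]
      exact ih₂.2 _ (ih₁.2 H hH)
  | inv Φ _ ih =>
    refine ⟨ih.2, fun H hH => ?_⟩
    rw [inv_inv]
    exact ih.1 H hH

end Setting

/-! ## 3. At the settings assembled over real packets (`Setting.ofComparison`) -/

namespace Setting

open Thm311 Literature.IUT.LogThetaLattice Literature.IUT.LogVolume

variable {T : ThetaIndex} {S : Situation T}

variable (n : ℤ) {HT : Type} {LogLink : HT → HT → Type} {IsFull : ∀ {s t : HT}, LogLink s t → Prop}
  (lat : LGPGaussianLogThetaLattice LogLink IsFull)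
  {Frd : Type} {IsoF : Frd → Frd → Type} {Ob : Frd → Type} {realify : Frd → Frd} {Strip : Type}
  {IsoS : Strip → Strip → Type} {M : ∀ v : T.V, v ∈ T.Vbad → Type} [∀ v h, Monoid (M v h)]
  (sig : GlobalLGPFrobenioidSignature T.lstar T.V (· ∈ T.Vbad) Frd IsoF Ob realify Strip IsoS M)
  (split : SplittingMonoids M) {ObΔ : Type} {N : ∀ v : T.V, v ∈ T.Vbad → Type} [∀ v h, Monoid (N v h)]
  (qData : QPilotData ObΔ N) (R : RealPieces S (Ob sig.Clgp) ObΔ)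
  (hq : ∀ j vQ i, R.qCentre (qPilotObject qData) j vQ i ≠ 0)
  (hadm : ∀ j vQ (H : Set (∀ i, R.K j vQ i)), IsHullSet (R.K j vQ) H → (S.D n).Adm j vQ (R.e j vQ ⁻¹' H))
  (hfin : ∀ j : T.Label, (Function.support fun vQ => (S.D n).logvol j vQ
    (R.e j vQ ⁻¹' hullSet (R.K j vQ) (R.qCentre (qPilotObject qData) j vQ))).Finite)
  -- the comparison maps are ONTO the completed packets at the label packets ([IUTchIII] Prop. 3.1 (i))
  (hsurj : ∀ (i : Fin T.lstar) (vQ : T.VQ), Function.Surjective (R.e (labelSucc i) vQ))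
  -- generator-level hull-set stability of (Ind1), (Ind2) at the label packets
  (hgen : ∀ (i : Fin T.lstar) (vQ : T.VQ), ∀ Φ ∈ S.L.Ind1Family ∪ S.L.Ind2Family,
    ∃ Ψ : (∀ k, R.K (labelSucc i) vQ k) ≃ (∀ k, R.K (labelSucc i) vQ k),
      (∀ x, R.e (labelSucc i) vQ (Φ (labelSucc i) vQ x) = Ψ (R.e (labelSucc i) vQ x)) ∧
      (∀ H, IsHullSet (R.K (labelSucc i) vQ) H → IsHullSet (R.K (labelSucc i) vQ) (⇑Ψ '' H)) ∧
      (∀ H, IsHullSet (R.K (labelSucc i) vQ) H → IsHullSet (R.K (labelSucc i) vQ) (⇑Ψ.symm '' H)))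

include hsurj hgen

/-- At `Setting.ofComparison` the three frame hypotheses of `Cor312HullGlued` hold at every label packet:
`hHul` (§2), `hHas` and `hdeg` (`Cor312HullGlued` §5 at the pulled-back real frame). [claim: Mochizuki2012, status: disputed] -/
theorem frameHyps_ofComparison (i : Fin T.lstar) (vQ : T.VQ) :
    (∀ Φ ∈ indGroup S, ∀ H ∈ ((ofComparison n lat sig split qData R hq hadm hfin).frame (labelSucc i) vQ).Hul,
        Φ (labelSucc i) vQ '' H ∈ ((ofComparison n lat sig split qData R hq hadm hfin).frame (labelSucc i) vQ).Hul) ∧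
      (∀ H ∈ ((ofComparison n lat sig split qData R hq hadm hfin).frame (labelSucc i) vQ).Hul,
        ((ofComparison n lat sig split qData R hq hadm hfin).frame (labelSucc i) vQ).HasHull H) ∧
      (∀ U : Set (S.L.Packet (labelSucc i) vQ),
        ((ofComparison n lat sig split qData R hq hadm hfin).frame (labelSucc i) vQ).IsBounded U →
        ((ofComparison n lat sig split qData R hq hadm hfin).frame (labelSucc i) vQ).HasHull
          (((ofComparison n lat sig split qData R hq hadm hfin).frame (labelSucc i) vQ).hull U) →
        ((ofComparison n lat sig split qData R hq hadm hfin).frame (labelSucc i) vQ).HasHull U) := by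
  rw [ofComparison_frame]
  refine ⟨fun Φ hΦ => ?_, fun H hH => ?_, fun U hU h => ?_⟩
  · refine mapsHul_comap_of_generators (HullFrame.ofLocalFields (R.K (labelSucc i) vQ)) (R.e (labelSucc i) vQ)
      (fun Φ hΦ' => ?_) hΦ
    obtain ⟨Ψ, hcomm, hΨ, hΨ'⟩ := hgen i vQ Φ hΦ'
    exact ⟨Ψ, hcomm, fun H hH => hΨ H hH, fun H hH => hΨ' H hH⟩
  · exact HullFrame.comap_ofLocalFields_hasHull_of_mem (R.K (labelSucc i) vQ) (hsurj i vQ) hH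
  · exact HullFrame.comap_ofLocalFields_hasHull_of_hasHull_hull (R.K (labelSucc i) vQ) (hsurj i vQ) hU h

/-- **At the real frames, `−|log(Θ)|` is unchanged by the hull-gluing.** [claim: Mochizuki2012, status: disputed] -/
theorem hullGlued_negLogTheta_ofComparison :
    (ofComparison n lat sig split qData R hq hadm hfin).hullGlued.negLogTheta =
      (ofComparison n lat sig split qData R hq hadm hfin).negLogTheta :=
  (ofComparison n lat sig split qData R hq hadm hfin).hullGlued_negLogTheta
    (fun i vQ => (frameHyps_ofComparison n lat sig split qData R hq hadm hfin hsurj hgen i vQ).1)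
    (fun i vQ => (frameHyps_ofComparison n lat sig split qData R hq hadm hfin hsurj hgen i vQ).2.1)
    (fun i vQ => (frameHyps_ofComparison n lat sig split qData R hq hadm hfin hsurj hgen i vQ).2.2)

/-- **At the real frames, the typed Statement is EQUIVALENT for the setting and its hull-gluing.**
[claim: Mochizuki2012, status: disputed] -/
theorem hullGlued_statement_iff_ofComparison :
    (ofComparison n lat sig split qData R hq hadm hfin).hullGlued.Statement ↔
      (ofComparison n lat sig split qData R hq hadm hfin).Statement :=
  (ofComparison n lat sig split qData R hq hadm hfin).hullGlued_statement_iff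
    (fun i vQ => (frameHyps_ofComparison n lat sig split qData R hq hadm hfin hsurj hgen i vQ).1)
    (fun i vQ => (frameHyps_ofComparison n lat sig split qData R hq hadm hfin hsurj hgen i vQ).2.1)
    (fun i vQ => (frameHyps_ofComparison n lat sig split qData R hq hadm hfin hsurj hgen i vQ).2.2)

end Setting

end Summit.ABC.IUTFork.Cor312

namespace Summit.ABC.IUTFork.Cor312Vol

open Thm311 Cor312 Cor312.Setting Literature.IUT.LogThetaLattice Literature.IUT.LogVolume

variable {T : ThetaIndex} {S : Situation T}

variable (n : ℤ) {HT : Type} {LogLink : HT → HT → Type} {IsFull : ∀ {s t : HT}, LogLink s t → Prop}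
  (lat : LGPGaussianLogThetaLattice LogLink IsFull)
  {Frd : Type} {IsoF : Frd → Frd → Type} {Ob : Frd → Type} {realify : Frd → Frd} {Strip : Type}
  {IsoS : Strip → Strip → Type} {M : ∀ v : T.V, v ∈ T.Vbad → Type} [∀ v h, Monoid (M v h)]
  (sig : GlobalLGPFrobenioidSignature T.lstar T.V (· ∈ T.Vbad) Frd IsoF Ob realify Strip IsoS M)
  (split : SplittingMonoids M) {ObΔ : Type} {N : ∀ v : T.V, v ∈ T.Vbad → Type} [∀ v h, Monoid (N v h)]
  (qData : QPilotData ObΔ N) (R : RealPieces S (Ob sig.Clgp) ObΔ)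
  (hq : ∀ j vQ i, R.qCentre (qPilotObject qData) j vQ i ≠ 0)
  (hadm : ∀ j vQ (H : Set (∀ i, R.K j vQ i)), IsHullSet (R.K j vQ) H → (S.D n).Adm j vQ (R.e j vQ ⁻¹' H))
  (hfin : ∀ j : T.Label, (Function.support fun vQ => (S.D n).logvol j vQ
    (R.e j vQ ⁻¹' hullSet (R.K j vQ) (R.qCentre (qPilotObject qData) j vQ))).Finite)
  (hsurj : ∀ (i : Fin T.lstar) (vQ : T.VQ), Function.Surjective (R.e (labelSucc i) vQ))
  (hgen : ∀ (i : Fin T.lstar) (vQ : T.VQ), ∀ Φ ∈ S.L.Ind1Family ∪ S.L.Ind2Family,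
    ∃ Ψ : (∀ k, R.K (labelSucc i) vQ k) ≃ (∀ k, R.K (labelSucc i) vQ k),
      (∀ x, R.e (labelSucc i) vQ (Φ (labelSucc i) vQ x) = Ψ (R.e (labelSucc i) vQ x)) ∧
      (∀ H, IsHullSet (R.K (labelSucc i) vQ) H → IsHullSet (R.K (labelSucc i) vQ) (⇑Ψ '' H)) ∧
      (∀ H, IsHullSet (R.K (labelSucc i) vQ) H → IsHullSet (R.K (labelSucc i) vQ) (⇑Ψ.symm '' H)))

include hsurj hgen

/-- **`BridgeHyps` is transported to the hull-glued setting at the real frames.** [claim: Mochizuki2012, status: disputed] -/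
theorem bridgeHyps_hullGlued_ofComparison
    (H : BridgeHyps (Setting.ofComparison n lat sig split qData R hq hadm hfin)) :
    BridgeHyps (Setting.ofComparison n lat sig split qData R hq hadm hfin).hullGlued :=
  bridgeHyps_hullGlued H
    (fun i vQ => (frameHyps_ofComparison n lat sig split qData R hq hadm hfin hsurj hgen i vQ).1)
    (fun i vQ => (frameHyps_ofComparison n lat sig split qData R hq hadm hfin hsurj hgen i vQ).2.1)

/-- **Summary at the real frames.** Under `BridgeHyps`, surjective comparisons and generator-level hull-set
stability of (Ind1)/(Ind2): the hull-glued setting satisfies `BridgeHyps` and `ThetaRegionsAdm`, has `hθ` at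
every label packet, the same `|log(q)| > 0` clause and `−|log(Θ)|`, and a typed Statement EQUIVALENT to the
original one. [claim: Mochizuki2012, status: disputed] -/
theorem hullGlued_summary_ofComparison
    (H : BridgeHyps (Setting.ofComparison n lat sig split qData R hq hadm hfin)) :
    BridgeHyps (Setting.ofComparison n lat sig split qData R hq hadm hfin).hullGlued ∧
      ThetaRegionsAdm (Setting.ofComparison n lat sig split qData R hq hadm hfin).hullGlued ∧
      (∀ (i : Fin T.lstar) (vQ : T.VQ), (S.D n).Adm _ vQ
        ((Setting.ofComparison n lat sig split qData R hq hadm hfin).hullGlued.thetaRegion3 (labelSucc i) vQ)) ∧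
      (Setting.ofComparison n lat sig split qData R hq hadm hfin).hullGlued.negLogTheta =
        (Setting.ofComparison n lat sig split qData R hq hadm hfin).negLogTheta ∧
      ((Setting.ofComparison n lat sig split qData R hq hadm hfin).hullGlued.Statement ↔
        (Setting.ofComparison n lat sig split qData R hq hadm hfin).Statement) :=
  ⟨bridgeHyps_hullGlued_ofComparison n lat sig split qData R hq hadm hfin hsurj hgen H,
    thetaRegionsAdm_hullGlued fun i vQ => hullDefined_of_finite H i vQ,
    fun i vQ => (Setting.ofComparison n lat sig split qData R hq hadm hfin).adm_thetaRegion3_hullGlued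
      (hullDefined_of_finite H i vQ),
    hullGlued_negLogTheta_ofComparison n lat sig split qData R hq hadm hfin hsurj hgen,
    hullGlued_statement_iff_ofComparison n lat sig split qData R hq hadm hfin hsurj hgen⟩

end Summit.ABC.IUTFork.Cor312Vol

end
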